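import Mathlib
import Summits.PneNP.PneNP.Theorems.OverlapGapAlgebraSolvableImpliesStableSectionMonotoneRepairTreeFamily
import Summits.PneNP.PneNP.Theorems.OverlapGapAlgebraSolvableImpliesStableSectionMonotoneRepairTreeCompose
import Summits.PneNP.PneNP.Theorems.OverlapGapAlgebraSolvableImpliesStableSectionMonotoneRepairDynamics

/-!
# PneNP / OverlapGapAlgebra — crux `SolvableImpliesStableSection` (stmt-PneNP-2463):
# the MONOTONE REPAIR block (10/·) — every violated clause has a valid witness tree

Support for crux `stmt-PneNP-2463` (`Summit.PneNP.PneNP.Theses.OverlapGapAlgebra.SolvableImpliesStableSection`):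
the f-free block "bounded-round monotone repair gives stable sections up to `α ≤ 2^k/(4k)`".
The bridge from the repair dynamics (`…MonotoneRepairDynamics`) to the tree codes
(`…MonotoneRepairTreeAsm/Family/Compose`): a clause violated at round `t` has all its literals false,
so each NEGATIVE slot carries a never-flipped variable (no child) and each POSITIVE slot a variable
flipped at an earlier round `s < t` by a clause violated at round `s` whose least negative slot carries
it (a child, built recursively); a clause violated at round `t ≥ 1` with a negative slot was satisfied at
round `t - 1`, so one of its positive variables was flipped at round `t - 1` exactly (recency).

* `sissR_build_children` — the slot data of a violated clause: subtrees for the positive slots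
  (from witness trees of earlier rounds), none for the negative ones; the assembled code is
  syntactically valid;
* `sissR_build` — every clause violated at round `t ≤ L` with a negative slot is the root of a code of
  `TS t` that is syntactically valid in `Φ`, locally valid, with a childless root slot;
* `sissR_rootBuild` — every clause violated at round `L` is the root (round `L`) of a syntactically and
  locally valid code of `TS L` (dead clauses: all `k` root slots bear children).
No definitions (all objects are hypotheses); axioms `propext`, `Classical.choice`, `Quot.sound`.
-/

set_option linter.dupNamespace false -- `Summit.PneNP.PneNP.…`: summit = sub-problem (D-0017)

namespace Summit.PneNP.PneNP.Theorems

open Finset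
open scoped Classical

section Build

variable {m k n : ℕ}

/-- **The slot data of a violated clause.** Let clause `i` be violated at round `t`, and suppose every
clause violated at a round `s < t` with a negative slot is the root of a good code of `TS s`. Then
there are slot data `ch` — `none` at the negative slots of `i`, at each positive slot `j` a good code of
`TS (t-1)` rooted at a clause of round `s < t` flipping the variable of `(i, j)` at round `s` — and the
assembled code `asm i t ch` is syntactically valid in `Φ`. -/
theorem sissR_build_children (asm : Fin m → ℕ → (Fin k → Option (Finset (List (Fin k) × (Fin m × ℕ)))) → Finset (List (Fin k) × (Fin m × ℕ)))
    (hasm : ∀ (c : Fin m) (r : ℕ) (ch : Fin k → Option (Finset (List (Fin k) × (Fin m × ℕ))))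
      (e : (List (Fin k) × (Fin m × ℕ))), e ∈ asm c r ch ↔ (e = ([], (c, r)) ∨
      ∃ (j : Fin k) (S : Finset (List (Fin k) × (Fin m × ℕ))), ch j = some S ∧
        ∃ b : List (Fin k), (b, e.2) ∈ S ∧ e.1 = b ++ [j]))
    (TS : ℕ → Finset (Finset (List (Fin k) × (Fin m × ℕ)))) (L : ℕ)
    (hTS0 : ∀ T : Finset (List (Fin k) × (Fin m × ℕ)), T ∈ TS 0 ↔
      ∃ (c : Fin m) (r : ℕ), r ≤ L ∧ T = asm c r (fun _ => none))
    (hTSs : ∀ (d : ℕ) (T : Finset (List (Fin k) × (Fin m × ℕ))), T ∈ TS (d + 1) ↔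
      ∃ (c : Fin m) (r : ℕ), r ≤ L ∧ ∃ ch : Fin k → Option (Finset (List (Fin k) × (Fin m × ℕ))),
        (∀ (j : Fin k) (S : Finset (List (Fin k) × (Fin m × ℕ))), ch j = some S → S ∈ TS d) ∧ T = asm c r ch)
    (val : ℕ → (Fin m → Fin k → Fin n × Bool) → Fin n → Bool)
    (hval0 : ∀ (Φ : (Fin m → Fin k → Fin n × Bool)) (v : Fin n), val 0 Φ v = true)
    (hvalS : ∀ (t : ℕ) (Φ : (Fin m → Fin k → Fin n × Bool)) (v : Fin n), val (t + 1) Φ v = true ↔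
      (val t Φ v = true ∧ ¬ (∃ ii : Fin m, (∀ jj : Fin k, val t Φ (Φ ii jj).1 ≠ (Φ ii jj).2) ∧
        ∃ jf : Fin k, (Φ ii jf).2 = false ∧ (∀ j' : Fin k, j' < jf → (Φ ii j').2 = true) ∧ (Φ ii jf).1 = v)))
    (Φ : (Fin m → Fin k → Fin n × Bool)) (t : ℕ) (i : Fin m) (hviol : (∀ jj : Fin k, val t Φ (Φ i jj).1 ≠ (Φ i jj).2))
    (hIH : ∀ s : ℕ, s < t → ∀ y : Fin m, ((∀ jj : Fin k, val s Φ (Φ y jj).1 ≠ (Φ y jj).2)) → (∃ j : Fin k, (Φ y j).2 = false) →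
      ∃ T ∈ TS s, (([] : List (Fin k)), (y, s)) ∈ T ∧ (∀ e ∈ T, ∀ j : Fin k,
      (((Φ e.2.1 j).2 = true ↔ ∃ lab : Fin m × ℕ, (j :: e.1, lab) ∈ T) ∧
      ∀ (y : Fin m) (s : ℕ), (j :: e.1, (y, s)) ∈ T → ∃ j' : Fin k,
        (∀ lab : Fin m × ℕ, (j' :: j :: e.1, lab) ∉ T) ∧
        (∀ j'' : Fin k, j'' < j' → ∃ lab : Fin m × ℕ, (j'' :: j :: e.1, lab) ∈ T) ∧
        (Φ e.2.1 j).1 = (Φ y j').1)) ∧ ((∀ e ∈ T, ∀ (j : Fin k) (y : Fin m) (s : ℕ), (j :: e.1, (y, s)) ∈ T →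
        s < e.2.2 ∧ ∃ j' : Fin k, ∀ lab : Fin m × ℕ, (j' :: j :: e.1, lab) ∉ T) ∧
      (∀ e ∈ T, 1 ≤ e.2.2 → (∃ (j : Fin k) (y : Fin m), (j :: e.1, (y, e.2.2 - 1)) ∈ T) ∨
        (e.1 = [] ∧ ∀ j : Fin k, ∃ lab : Fin m × ℕ, ([j], lab) ∈ T))) ∧ (∃ j : Fin k, ∀ lab : Fin m × ℕ, ([j], lab) ∉ T)) :
    ∃ ch : Fin k → Option (Finset (List (Fin k) × (Fin m × ℕ))),
      (∀ j : Fin k, (Φ i j).2 = false → ch j = none) ∧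
      (∀ j : Fin k, (Φ i j).2 = true → ∃ (S : Finset (List (Fin k) × (Fin m × ℕ))) (y : Fin m) (s : ℕ), ch j = some S ∧ s < t ∧
        (([] : List (Fin k)), (y, s)) ∈ S ∧ (∃ ii : Fin m, (∀ jj : Fin k, val s Φ (Φ ii jj).1 ≠ (Φ ii jj).2) ∧
        ∃ jf : Fin k, (Φ ii jf).2 = false ∧ (∀ j' : Fin k, j' < jf → (Φ ii j').2 = true) ∧ (Φ ii jf).1 = (Φ i j).1)) ∧
      (∀ (j : Fin k) (S : Finset (List (Fin k) × (Fin m × ℕ))), ch j = some S → S ∈ TS (t - 1) ∧ ((∀ e ∈ S, ∀ (j : Fin k) (y : Fin m) (s : ℕ), (j :: e.1, (y, s)) ∈ S →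
        s < e.2.2 ∧ ∃ j' : Fin k, ∀ lab : Fin m × ℕ, (j' :: j :: e.1, lab) ∉ S) ∧
      (∀ e ∈ S, 1 ≤ e.2.2 → (∃ (j : Fin k) (y : Fin m), (j :: e.1, (y, e.2.2 - 1)) ∈ S) ∨
        (e.1 = [] ∧ ∀ j : Fin k, ∃ lab : Fin m × ℕ, ([j], lab) ∈ S))) ∧ (∃ j : Fin k, ∀ lab : Fin m × ℕ, ([j], lab) ∉ S) ∧
        (∃ (y : Fin m) (s : ℕ), (([] : List (Fin k)), (y, s)) ∈ S ∧ s < t) ∧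
        ∀ lab lab' : Fin m × ℕ, (([] : List (Fin k)), lab) ∈ S → (([] : List (Fin k)), lab') ∈ S →
          lab = lab') ∧
      ∀ e ∈ asm i t ch, ∀ j : Fin k,
      (((Φ e.2.1 j).2 = true ↔ ∃ lab : Fin m × ℕ, (j :: e.1, lab) ∈ asm i t ch) ∧
      ∀ (y : Fin m) (s : ℕ), (j :: e.1, (y, s)) ∈ asm i t ch → ∃ j' : Fin k,
        (∀ lab : Fin m × ℕ, (j' :: j :: e.1, lab) ∉ asm i t ch) ∧
        (∀ j'' : Fin k, j'' < j' → ∃ lab : Fin m × ℕ, (j'' :: j :: e.1, lab) ∈ asm i t ch) ∧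
        (Φ e.2.1 j).1 = (Φ y j').1) := by
  -- slotwise choice
  have key : ∀ j : Fin k, ∃ o : Option (Finset (List (Fin k) × (Fin m × ℕ))),
      ((Φ i j).2 = false → o = none) ∧
      ((Φ i j).2 = true → ∃ (S : Finset (List (Fin k) × (Fin m × ℕ))) (y : Fin m) (s : ℕ), o = some S ∧ s < t ∧ S ∈ TS s ∧
        (([] : List (Fin k)), (y, s)) ∈ S ∧ (∀ e ∈ S, ∀ j : Fin k,
      (((Φ e.2.1 j).2 = true ↔ ∃ lab : Fin m × ℕ, (j :: e.1, lab) ∈ S) ∧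
      ∀ (y : Fin m) (s : ℕ), (j :: e.1, (y, s)) ∈ S → ∃ j' : Fin k,
        (∀ lab : Fin m × ℕ, (j' :: j :: e.1, lab) ∉ S) ∧
        (∀ j'' : Fin k, j'' < j' → ∃ lab : Fin m × ℕ, (j'' :: j :: e.1, lab) ∈ S) ∧
        (Φ e.2.1 j).1 = (Φ y j').1)) ∧ ((∀ e ∈ S, ∀ (j : Fin k) (y : Fin m) (s : ℕ), (j :: e.1, (y, s)) ∈ S →
        s < e.2.2 ∧ ∃ j' : Fin k, ∀ lab : Fin m × ℕ, (j' :: j :: e.1, lab) ∉ S) ∧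
      (∀ e ∈ S, 1 ≤ e.2.2 → (∃ (j : Fin k) (y : Fin m), (j :: e.1, (y, e.2.2 - 1)) ∈ S) ∨
        (e.1 = [] ∧ ∀ j : Fin k, ∃ lab : Fin m × ℕ, ([j], lab) ∈ S))) ∧ (∃ j : Fin k, ∀ lab : Fin m × ℕ, ([j], lab) ∉ S) ∧
        ((∃ ii : Fin m, (∀ jj : Fin k, val s Φ (Φ ii jj).1 ≠ (Φ ii jj).2) ∧
        ∃ jf : Fin k, (Φ ii jf).2 = false ∧ (∀ j' : Fin k, j' < jf → (Φ ii j').2 = true) ∧ (Φ ii jf).1 = (Φ i j).1)) ∧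
        ∃ jf : Fin k, ((Φ y jf).2 = false ∧ ∀ j' : Fin k, j' < jf → (Φ y j').2 = true) ∧
          (Φ i j).1 = (Φ y jf).1) := by
    intro j
    by_cases hsj : (Φ i j).2 = true
    · -- positive slot: its variable is false at round `t`, hence was flipped earlier
      have hvf : val t Φ (Φ i j).1 = false := by
        have := hviol j
        rw [hsj] at this
        cases h : val t Φ (Φ i j).1
        · rfl
        · exact absurd h this
      obtain ⟨s, hs, hfl⟩ := sissR_exists_flip val hval0 hvalS Φ (Φ i j).1 t hvf
      obtain ⟨y, hvy, jf, hjf, hlt, hvar⟩ := hfl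
      obtain ⟨S, hS, hroot, hsyn, hloc, hno⟩ := hIH s hs y hvy ⟨jf, hjf⟩
      refine ⟨some S, fun h => ?_, fun _ => ⟨S, y, s, rfl, hs, hS, hroot, hsyn, hloc, hno,
        ⟨y, hvy, jf, hjf, hlt, hvar⟩, jf, ⟨hjf, hlt⟩, hvar.symm⟩⟩
      rw [hsj] at h
      exact absurd h (by simp)
    · refine ⟨none, fun _ => rfl, fun h => absurd h hsj⟩
  choose ch hch using key
  -- basic facts about the chosen data
  have hsome : ∀ (j : Fin k) (S : Finset (List (Fin k) × (Fin m × ℕ))), ch j = some S → (Φ i j).2 = true := by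
    intro j S hS
    by_contra h
    have h' : (Φ i j).2 = false := by simpa using h
    rw [(hch j).1 h'] at hS
    exact absurd hS (by simp)
  have hdata : ∀ (j : Fin k) (S : Finset (List (Fin k) × (Fin m × ℕ))), ch j = some S → ∃ (y : Fin m) (s : ℕ), s < t ∧ S ∈ TS s ∧
      (([] : List (Fin k)), (y, s)) ∈ S ∧ (∀ e ∈ S, ∀ j : Fin k,
      (((Φ e.2.1 j).2 = true ↔ ∃ lab : Fin m × ℕ, (j :: e.1, lab) ∈ S) ∧
      ∀ (y : Fin m) (s : ℕ), (j :: e.1, (y, s)) ∈ S → ∃ j' : Fin k,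
        (∀ lab : Fin m × ℕ, (j' :: j :: e.1, lab) ∉ S) ∧
        (∀ j'' : Fin k, j'' < j' → ∃ lab : Fin m × ℕ, (j'' :: j :: e.1, lab) ∈ S) ∧
        (Φ e.2.1 j).1 = (Φ y j').1)) ∧ ((∀ e ∈ S, ∀ (j : Fin k) (y : Fin m) (s : ℕ), (j :: e.1, (y, s)) ∈ S →
        s < e.2.2 ∧ ∃ j' : Fin k, ∀ lab : Fin m × ℕ, (j' :: j :: e.1, lab) ∉ S) ∧
      (∀ e ∈ S, 1 ≤ e.2.2 → (∃ (j : Fin k) (y : Fin m), (j :: e.1, (y, e.2.2 - 1)) ∈ S) ∨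
        (e.1 = [] ∧ ∀ j : Fin k, ∃ lab : Fin m × ℕ, ([j], lab) ∈ S))) ∧ (∃ j : Fin k, ∀ lab : Fin m × ℕ, ([j], lab) ∉ S) ∧
      ((∃ ii : Fin m, (∀ jj : Fin k, val s Φ (Φ ii jj).1 ≠ (Φ ii jj).2) ∧
        ∃ jf : Fin k, (Φ ii jf).2 = false ∧ (∀ j' : Fin k, j' < jf → (Φ ii j').2 = true) ∧ (Φ ii jf).1 = (Φ i j).1)) ∧
      ∃ jf : Fin k, ((Φ y jf).2 = false ∧ ∀ j' : Fin k, j' < jf → (Φ y j').2 = true) ∧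
        (Φ i j).1 = (Φ y jf).1 := by
    intro j S hS
    obtain ⟨S', y, s, hS', hs, hTS, hroot, hsyn, hloc, hno, hfl, hjf⟩ := (hch j).2 (hsome j S hS)
    rw [hS] at hS'
    cases hS'
    exact ⟨y, s, hs, hTS, hroot, hsyn, hloc, hno, hfl, hjf⟩
  have hfunS : ∀ (j : Fin k) (S : Finset (List (Fin k) × (Fin m × ℕ))), ch j = some S → ∀ lab lab' : Fin m × ℕ,
      (([] : List (Fin k)), lab) ∈ S → (([] : List (Fin k)), lab') ∈ S → lab = lab' := by
    intro j S hS
    obtain ⟨y, s, _, hTS, _⟩ := hdata j S hS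
    exact fun lab lab' h h' => (sissR_TS_valid asm hasm TS L hTS0 hTSs s S hTS).2.1 [] lab lab' h h'
  refine ⟨ch, fun j h => (hch j).1 h, fun j h => ?_, fun j S hS => ?_, ?_⟩
  · obtain ⟨S, y, s, hS, hs, _, hroot, _, _, _, hfl, _⟩ := (hch j).2 h
    exact ⟨S, y, s, hS, hs, hroot, hfl⟩
  · obtain ⟨y, s, hs, hTS, hroot, _, hloc, hno, _⟩ := hdata j S hS
    exact ⟨sissR_TS_mono_le asm TS L hTS0 hTSs s (t - 1) (by omega) S hTS, hloc, hno,
      ⟨y, s, hroot, hs⟩, hfunS j S hS⟩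
  · -- syntactic validity of the assembled code
    refine sissR_synv_asm asm hasm Φ i t ch (fun j => ?_) hfunS (fun j S hS => ?_)
    · constructor
      · intro h
        obtain ⟨S, y, s, hS, _⟩ := (hch j).2 h
        exact ⟨S, hS⟩
      · rintro ⟨S, hS⟩
        exact hsome j S hS
    · obtain ⟨y, s, _, _, hroot, hsyn, _, _, _, jf, ⟨hjf, hlt⟩, heq⟩ := hdata j S hS
      refine ⟨hsyn, y, s, hroot, jf, ?_, ?_, heq⟩
      · -- `jf` is childless at the root of `S`: its sign is negative
        intro lab hlab
        have := ((hsyn _ hroot jf).1).2 ⟨lab, hlab⟩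
        rw [hjf] at this
        exact absurd this (by simp)
      · intro j'' hj''
        exact ((hsyn _ hroot j'').1).1 (hlt j'' hj'')

/-- **Every flipping clause has a good witness tree.** For every round `t ≤ L`: every clause violated at
round `t` that has a negative slot is the root (round `t`) of a code of `TS t` that is syntactically
valid in `Φ`, locally valid, and has a childless root slot. -/
theorem sissR_build (asm : Fin m → ℕ → (Fin k → Option (Finset (List (Fin k) × (Fin m × ℕ)))) → Finset (List (Fin k) × (Fin m × ℕ)))
    (hasm : ∀ (c : Fin m) (r : ℕ) (ch : Fin k → Option (Finset (List (Fin k) × (Fin m × ℕ))))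
      (e : (List (Fin k) × (Fin m × ℕ))), e ∈ asm c r ch ↔ (e = ([], (c, r)) ∨
      ∃ (j : Fin k) (S : Finset (List (Fin k) × (Fin m × ℕ))), ch j = some S ∧
        ∃ b : List (Fin k), (b, e.2) ∈ S ∧ e.1 = b ++ [j]))
    (TS : ℕ → Finset (Finset (List (Fin k) × (Fin m × ℕ)))) (L : ℕ)
    (hTS0 : ∀ T : Finset (List (Fin k) × (Fin m × ℕ)), T ∈ TS 0 ↔
      ∃ (c : Fin m) (r : ℕ), r ≤ L ∧ T = asm c r (fun _ => none))
    (hTSs : ∀ (d : ℕ) (T : Finset (List (Fin k) × (Fin m × ℕ))), T ∈ TS (d + 1) ↔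
      ∃ (c : Fin m) (r : ℕ), r ≤ L ∧ ∃ ch : Fin k → Option (Finset (List (Fin k) × (Fin m × ℕ))),
        (∀ (j : Fin k) (S : Finset (List (Fin k) × (Fin m × ℕ))), ch j = some S → S ∈ TS d) ∧ T = asm c r ch)
    (val : ℕ → (Fin m → Fin k → Fin n × Bool) → Fin n → Bool)
    (hval0 : ∀ (Φ : (Fin m → Fin k → Fin n × Bool)) (v : Fin n), val 0 Φ v = true)
    (hvalS : ∀ (t : ℕ) (Φ : (Fin m → Fin k → Fin n × Bool)) (v : Fin n), val (t + 1) Φ v = true ↔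
      (val t Φ v = true ∧ ¬ (∃ ii : Fin m, (∀ jj : Fin k, val t Φ (Φ ii jj).1 ≠ (Φ ii jj).2) ∧
        ∃ jf : Fin k, (Φ ii jf).2 = false ∧ (∀ j' : Fin k, j' < jf → (Φ ii j').2 = true) ∧ (Φ ii jf).1 = v)))
    (Φ : (Fin m → Fin k → Fin n × Bool)) :
    ∀ t : ℕ, t ≤ L → ∀ i : Fin m, ((∀ jj : Fin k, val t Φ (Φ i jj).1 ≠ (Φ i jj).2)) → (∃ j : Fin k, (Φ i j).2 = false) →
      ∃ T ∈ TS t, (([] : List (Fin k)), (i, t)) ∈ T ∧ (∀ e ∈ T, ∀ j : Fin k,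
      (((Φ e.2.1 j).2 = true ↔ ∃ lab : Fin m × ℕ, (j :: e.1, lab) ∈ T) ∧
      ∀ (y : Fin m) (s : ℕ), (j :: e.1, (y, s)) ∈ T → ∃ j' : Fin k,
        (∀ lab : Fin m × ℕ, (j' :: j :: e.1, lab) ∉ T) ∧
        (∀ j'' : Fin k, j'' < j' → ∃ lab : Fin m × ℕ, (j'' :: j :: e.1, lab) ∈ T) ∧
        (Φ e.2.1 j).1 = (Φ y j').1)) ∧ ((∀ e ∈ T, ∀ (j : Fin k) (y : Fin m) (s : ℕ), (j :: e.1, (y, s)) ∈ T →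
        s < e.2.2 ∧ ∃ j' : Fin k, ∀ lab : Fin m × ℕ, (j' :: j :: e.1, lab) ∉ T) ∧
      (∀ e ∈ T, 1 ≤ e.2.2 → (∃ (j : Fin k) (y : Fin m), (j :: e.1, (y, e.2.2 - 1)) ∈ T) ∨
        (e.1 = [] ∧ ∀ j : Fin k, ∃ lab : Fin m × ℕ, ([j], lab) ∈ T))) ∧ (∃ j : Fin k, ∀ lab : Fin m × ℕ, ([j], lab) ∉ T) := by
  intro t
  induction t using Nat.strong_induction_on with
  | _ t ih =>
    intro htL i hviol hneg
    obtain ⟨ch, hchneg, hchpos, hchS, hsyn⟩ := sissR_build_children asm hasm TS L hTS0 hTSs val hval0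
      hvalS Φ t i hviol (fun s hs y hy hyn => ih s hs (by omega) y hy hyn)
    refine ⟨asm i t ch, ?_, (sissR_asm_mem_nil asm hasm i t ch (i, t)).2 rfl, hsyn, ?_, ?_⟩
    · -- membership in `TS t`
      rcases Nat.eq_zero_or_pos t with rfl | ht
      · have hnone : ch = fun _ => none := by
          funext j
          cases hsj : (Φ i j).2
          · exact hchneg j hsj
          · obtain ⟨S, y, s, _, hs, _⟩ := hchpos j hsj
            exact absurd hs (Nat.not_lt_zero s)
        rw [hnone]
        exact (hTS0 _).2 ⟨i, 0, htL, rfl⟩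
      · have ht1 : t - 1 + 1 = t := Nat.sub_add_cancel ht
        rw [← ht1]
        refine (hTSs (t - 1) _).2 ⟨i, t - 1 + 1, by omega, ch, fun j S hS => (hchS j S hS).1, ?_⟩
        rw [ht1]
    · -- local validity
      refine sissR_locv_asm_of asm hasm i t ch (fun j S hS => (hchS j S hS).2.2.2.2)
        (fun j S hS => ⟨(hchS j S hS).2.1, (hchS j S hS).2.2.1, (hchS j S hS).2.2.2.1⟩) (fun ht => ?_)
      left
      -- recency: newly violated at round `t`, broken by a flip at round `t - 1`
      have hnew := sissR_flipper_new val hvalS Φ i t ht hviol hneg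
      have hviol' : (∀ jj : Fin k, val (t - 1 + 1) Φ (Φ i jj).1 ≠ (Φ i jj).2) := by rw [Nat.sub_add_cancel ht]; exact hviol
      obtain ⟨j, hsj, hfl⟩ := sissR_newly_violated val hvalS Φ i (t - 1) hnew hviol'
      obtain ⟨S, y, s, hS, _, hroot, hfl'⟩ := hchpos j hsj
      have hst : s = t - 1 := sissR_flip_unique val hvalS Φ _ s (t - 1) hfl' hfl
      subst hst
      exact ⟨j, S, y, hS, hroot⟩
    · -- a childless root slot
      obtain ⟨j₀, hj₀⟩ := hneg
      exact (sissR_hasNone_asm asm hasm i t ch (fun j S hS =>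
        let ⟨y, s, hroot, _⟩ := (hchS j S hS).2.2.2.1
        ⟨(y, s), hroot⟩)).2 ⟨j₀, hchneg j₀ hj₀⟩

/-- **Every clause violated after `L` rounds has a valid witness tree** (`k ≥ 1`): it is the root
(round `L`) of a code of `TS L` that is syntactically valid in `Φ` and locally valid — with a recent
child if it has a negative slot (it is newly violated), with all `k` children if it is dead. -/
theorem sissR_rootBuild (asm : Fin m → ℕ → (Fin k → Option (Finset (List (Fin k) × (Fin m × ℕ)))) → Finset (List (Fin k) × (Fin m × ℕ)))
    (hasm : ∀ (c : Fin m) (r : ℕ) (ch : Fin k → Option (Finset (List (Fin k) × (Fin m × ℕ))))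
      (e : (List (Fin k) × (Fin m × ℕ))), e ∈ asm c r ch ↔ (e = ([], (c, r)) ∨
      ∃ (j : Fin k) (S : Finset (List (Fin k) × (Fin m × ℕ))), ch j = some S ∧
        ∃ b : List (Fin k), (b, e.2) ∈ S ∧ e.1 = b ++ [j]))
    (TS : ℕ → Finset (Finset (List (Fin k) × (Fin m × ℕ)))) (L : ℕ)
    (hTS0 : ∀ T : Finset (List (Fin k) × (Fin m × ℕ)), T ∈ TS 0 ↔
      ∃ (c : Fin m) (r : ℕ), r ≤ L ∧ T = asm c r (fun _ => none))
    (hTSs : ∀ (d : ℕ) (T : Finset (List (Fin k) × (Fin m × ℕ))), T ∈ TS (d + 1) ↔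
      ∃ (c : Fin m) (r : ℕ), r ≤ L ∧ ∃ ch : Fin k → Option (Finset (List (Fin k) × (Fin m × ℕ))),
        (∀ (j : Fin k) (S : Finset (List (Fin k) × (Fin m × ℕ))), ch j = some S → S ∈ TS d) ∧ T = asm c r ch)
    (val : ℕ → (Fin m → Fin k → Fin n × Bool) → Fin n → Bool)
    (hval0 : ∀ (Φ : (Fin m → Fin k → Fin n × Bool)) (v : Fin n), val 0 Φ v = true)
    (hvalS : ∀ (t : ℕ) (Φ : (Fin m → Fin k → Fin n × Bool)) (v : Fin n), val (t + 1) Φ v = true ↔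
      (val t Φ v = true ∧ ¬ (∃ ii : Fin m, (∀ jj : Fin k, val t Φ (Φ ii jj).1 ≠ (Φ ii jj).2) ∧
        ∃ jf : Fin k, (Φ ii jf).2 = false ∧ (∀ j' : Fin k, j' < jf → (Φ ii j').2 = true) ∧ (Φ ii jf).1 = v)))
    (hk : 1 ≤ k) (Φ : (Fin m → Fin k → Fin n × Bool)) (c : Fin m) (hviol : (∀ jj : Fin k, val L Φ (Φ c jj).1 ≠ (Φ c jj).2)) :
    ∃ T ∈ TS L, (([] : List (Fin k)), (c, L)) ∈ T ∧ (∀ e ∈ T, ∀ j : Fin k,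
      (((Φ e.2.1 j).2 = true ↔ ∃ lab : Fin m × ℕ, (j :: e.1, lab) ∈ T) ∧
      ∀ (y : Fin m) (s : ℕ), (j :: e.1, (y, s)) ∈ T → ∃ j' : Fin k,
        (∀ lab : Fin m × ℕ, (j' :: j :: e.1, lab) ∉ T) ∧
        (∀ j'' : Fin k, j'' < j' → ∃ lab : Fin m × ℕ, (j'' :: j :: e.1, lab) ∈ T) ∧
        (Φ e.2.1 j).1 = (Φ y j').1)) ∧ ((∀ e ∈ T, ∀ (j : Fin k) (y : Fin m) (s : ℕ), (j :: e.1, (y, s)) ∈ T →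
        s < e.2.2 ∧ ∃ j' : Fin k, ∀ lab : Fin m × ℕ, (j' :: j :: e.1, lab) ∉ T) ∧
      (∀ e ∈ T, 1 ≤ e.2.2 → (∃ (j : Fin k) (y : Fin m), (j :: e.1, (y, e.2.2 - 1)) ∈ T) ∨
        (e.1 = [] ∧ ∀ j : Fin k, ∃ lab : Fin m × ℕ, ([j], lab) ∈ T))) := by
  by_cases hneg : ∃ j : Fin k, (Φ c j).2 = false
  · obtain ⟨T, hT, hroot, hsyn, hloc, _⟩ :=
      sissR_build asm hasm TS L hTS0 hTSs val hval0 hvalS Φ L le_rfl c hviol hneg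
    exact ⟨T, hT, hroot, hsyn, hloc⟩
  · -- a dead clause: all slots positive, all variables flipped
    push Not at hneg
    have hpos : ∀ j : Fin k, (Φ c j).2 = true := fun j => by simpa using hneg j
    obtain ⟨ch, _, hchpos, hchS, hsyn⟩ := sissR_build_children asm hasm TS L hTS0 hTSs val hval0
      hvalS Φ L c hviol (fun s hs y hy hyn =>
        sissR_build asm hasm TS L hTS0 hTSs val hval0 hvalS Φ s hs.le y hy hyn)
    -- `L ≥ 1` (slot `0` was flipped at a round `< L`)
    have hL : 1 ≤ L := by
      obtain ⟨S, y, s, _, hs, _⟩ := hchpos ⟨0, hk⟩ (hpos ⟨0, hk⟩)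
      omega
    refine ⟨asm c L ch, ?_, (sissR_asm_mem_nil asm hasm c L ch (c, L)).2 rfl, hsyn, ?_⟩
    · have hL1 : L - 1 + 1 = L := Nat.sub_add_cancel hL
      rw [← hL1]
      refine (hTSs (L - 1) _).2 ⟨c, L - 1 + 1, by omega, ch, fun j S hS => (hchS j S hS).1, ?_⟩
      rw [hL1]
    · refine sissR_locv_asm_of asm hasm c L ch (fun j S hS => (hchS j S hS).2.2.2.2)
        (fun j S hS => ⟨(hchS j S hS).2.1, (hchS j S hS).2.2.1, (hchS j S hS).2.2.2.1⟩) (fun _ => ?_)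
      right
      intro j
      obtain ⟨S, y, s, hS, _, hroot, _⟩ := hchpos j (hpos j)
      exact ⟨S, (y, s), hS, hroot⟩

end Build

end Summit.PneNP.PneNP.Theorems
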